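import Mathlib
import Summits.Ventures.FusionMHD.Models.TearingFRS1DeltaPrime
import Literature.MathematicalPhysics.MHD.TearingMatchingData
import HarnessLib

/-!
# F3.r3 instance «TearingFRS1» × model-row-6 schema: ★ #13's glued outer solution HAS MATCHING DATA at `μ = ½`, and its
# generalised `Δ′ = β⁺/α⁺ + β⁻/α⁻` IS the certified jump `deltaPrime ∈ (5.12620, 5.12624)`

Companion of `TearingFRS1DeltaPrime.lean` (★ #13 «F3.r3 Δ′(FRS-1) SIGN», model-6 g3/g4) and of the statement schema
`Literature/MathematicalPhysics/MHD/TearingMatchingData.lean` (model-6 g8, p564202): the schema's `Tearing.IsMatchingData` /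
`Tearing.matchingDeltaPrime` (PEST-3 (63), Ham et al. `Δ′_∞ = β⁺/α⁺ + β⁻/α⁻`) INSTANTIATED on a certified row.  MODEL M and
all objects BY NAME from the ★ #13 chain: the glued outer solution `TearingFRS1.psi` (axis-regular, `ψ(1) = 1`, wall at `u = 6`),
the patch pair at the rational surface `u = 1` — small solution `ψ_s = (scalarSmallSol pc qc)·.1` (`ψ_s(0) = 0`, `ψ_s′(0) = 1`)
and large solution `ψ_L = (14/5) log|x| ψ_s + η` (`η(0) = 1`), `x = u − 1` — and the Cramer coefficients `bL`, `bR`.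

PROVED here (no numerics beyond ★ #13's):
* `deriv_small_zero` — `(ψ_s, ψ_s′)′(0) = (1, 9/5)` (term-wise differentiation of the Frobenius series, `small_val_1`,
  `small_bound2`): the small solution IS normalised, `ψ_s(x)/|x| → ±1`;
* `psi_repr_right` / `psi_repr_left` — on `0 < ±x < 1/2`: `ψ(1 + x) = ψ_L(x) + b_± ψ_s(x)` with `b₊ = bR`, `b₋ = bL`
  (the representation inside `isDeltaPrime_of_matching`, exported);
* **`isMatchingData_psi`** — with the basis `ψ_L^± = ψ_L` (leading power `0`), `ψ_S⁺ = ψ_s`, `ψ_S⁻ = −ψ_s` (leading power `1`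
  in `|x|`, Ham et al.'s `|x|^{ν_S}` convention): `Tearing.IsMatchingData 1 psi ψ_L ψ_s ψ_L (−ψ_s) 1 bR 1 (−bL)`, the four
  `HasLeadingPower` facts with `(ν_L, ν_S) = (0, 1) = (largeIndex ½, smallIndex ½)`;
* **`matchingDeltaPrime_psi`** — `Tearing.matchingDeltaPrime 1 bR 1 (−bL) = deltaPrime` (= `bR − bL`), hence
  **`5.12620 < β⁺/α⁺ + β⁻/α⁻ < 5.12624`** and `Tearing.IsDeltaPrime psi psi' 1 (matchingDeltaPrime …)`: at zero pressure
  gradient the finite-β matching datum and the FKR jump coincide ON THIS ROW (the schema's `isMatchingData_logBranch`,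
  PEST-3 (89)), with the tree's uniqueness `IsMatchingData.unique` making `(1, bR, 1, −bL)` THE data for this basis.
THREE COLUMNS: nothing new is certified numerically; MODELLED = ★ #13's MODEL M (zero β, `μ = ½`); the point is vocabulary —
a finite-β row (irrational `2μ`) will produce the same four numbers by the same schema. [instance data]
-/

noncomputable section

open Set Filter Literature.Analysis.ODE Literature.MathematicalPhysics.MHD Literature.MathematicalPhysics.MHD.Tearing
open scoped Topology

namespace Summit.Ventures.FusionMHD.Models

namespace TearingFRS1

/-! ### The small solution is normalised: `ψ_s′(0) = 1` -/

/-- **`(ψ_s, ψ_s′)′(0) = (s₁).1… = (1, 9/5)`**: the derivative AT the surface of the small Frobenius branch is its first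
Taylor coefficient `small_val_1` (term-wise differentiation of `Σ xⁿ sₙ` with `‖sₙ‖ ≤ (6/5)(8/5)ⁿ`, `small_bound2`).
[cite: CoddingtonLevinson1955, Ch. 4 §8] -/
theorem deriv_small_zero : deriv (scalarSmallSol pc qc) 0 = ((1 : ℝ), (9 / 5 : ℝ)) := by
  have h := (hasDerivAt_tsum_pow_smul (𝕜 := ℝ) small_bound2 (by norm_num) (x := (0 : ℝ)) (by simp)).2
  have e : (fun y : ℝ => ∑' n, y ^ n • frobeniusCoeff Msys (fun _ => 0) Rsys ((0 : ℝ), (1 : ℝ)) n) =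
      scalarSmallSol pc qc := rfl
  rw [e] at h
  rw [h.deriv, tsum_eq_single 1]
  · simp [small_val_1]
  · intro n hn
    rcases Nat.lt_or_gt_of_ne hn with h0 | h2
    · interval_cases n; simp
    · have : (0 : ℝ) ^ (n - 1) = 0 := zero_pow (by omega)
      rw [this, mul_zero, zero_smul]

/-- `ψ_s(x)/x → 1` at the surface (`ψ_s(0) = 0`, `ψ_s′(0) = 1`). [instance data] -/
theorem tendsto_small_div : Tendsto (fun x : ℝ => x⁻¹ * ((scalarSmallSol pc qc) x).1) (𝓝[≠] 0) (𝓝 1) := by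
  obtain ⟨hSd, -, -, -⟩ := smallPatchOn_half 0 (by norm_num)
  have hs : HasDerivAt (fun x => ((scalarSmallSol pc qc) x).1) ((deriv (scalarSmallSol pc qc) 0).1) 0 :=
    (ContinuousLinearMap.fst ℝ ℝ ℝ).hasFDerivAt.comp_hasDerivAt 0 hSd.hasDerivAt
  rw [deriv_small_zero] at hs
  have h0 : ((scalarSmallSol pc qc) 0).1 = 0 := by rw [small_zero]
  simpa only [zero_add, h0, sub_zero, smul_eq_mul] using hs.tendsto_slope_zero

/-! ### The representation of `ψ` on the two half-patches (exported from the matching step) -/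

/-- **On `0 < x < 1/2`: `ψ(1 + x) = ψ_L(x) + b_R ψ_s(x)`** (and the same for the derivative functions), `b_R = bR(…)` the
Cramer coefficient of ★ #13 — uniqueness on the right half-patch from the matching data at `x₀ = 1/4` (`wall_match`).
[instance data] -/
theorem psi_repr_right : ∀ x ∈ Ioo (0 : ℝ) (1 / 2),
    psi (1 + x) = ((scalarLogSol pc qc 1 (14 / 5) Real.log) x).1 + bR (wallR (5 / 4)) (wallR' (5 / 4)) * ((scalarSmallSol pc qc) x).1 ∧
      psi' (1 + x) = ((scalarLogSol pc qc 1 (14 / 5) Real.log) x).2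
        + bR (wallR (5 / 4)) (wallR' (5 / 4)) * ((scalarSmallSol pc qc) x).2 := by
  have hR : IsScaledOuterSolution (fun u => aR⁻¹ * wallR u) (fun u => aR⁻¹ * wallR' u) (Ioo 1 (1 + 1 / 2)) :=
    (wall_outer.mono fun u hu => hu.1).smul aR⁻¹
  have hFr : ∀ x ∈ Ioo (0 : ℝ) (1 / 2), HasDerivAt (fun z => aR⁻¹ * wallR (1 + z)) (aR⁻¹ * wallR' (1 + x)) x ∧
      HasDerivAt (fun z => aR⁻¹ * wallR' (1 + z)) (modelP x * (aR⁻¹ * wallR' (1 + x)) + modelQ x * (aR⁻¹ * wallR (1 + x))) x :=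
    fun x hx => outer_shift hR ⟨by linarith [hx.1], by linarith [hx.2]⟩
  have hacr : ∀ x ∈ Ioo (0 : ℝ) (1 / 2), |x| < 1 / 2 ∧ x ≠ 0 :=
    fun x hx => ⟨abs_lt.2 ⟨by linarith [hx.1], hx.2⟩, hx.1.ne'⟩
  have hRm : aR⁻¹ * wallR (1 + 1 / 4) = (scalarLogSol pc qc 1 (14 / 5) Real.log (1 / 4 : ℝ)).1
      + bR (wallR (5 / 4)) (wallR' (5 / 4)) * (scalarSmallSol pc qc (1 / 4 : ℝ)).1 := by
    rw [show (1 : ℝ) + 1 / 4 = 5 / 4 by norm_num]; exact wall_match.1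
  have hRm' : aR⁻¹ * wallR' (1 + 1 / 4) = (scalarLogSol pc qc 1 (14 / 5) Real.log (1 / 4 : ℝ)).2
      + bR (wallR (5 / 4)) (wallR' (5 / 4)) * (scalarSmallSol pc qc (1 / 4 : ℝ)).2 := by
    rw [show (1 : ℝ) + 1 / 4 = 5 / 4 by norm_num]; exact wall_match.2
  have repr := repr_of_match (δ := 1 / 2) le_rfl smallPatchOn_half logPatchOn_half hacr (t₀ := 1 / 4)
    ⟨by norm_num, by norm_num⟩ hFr (b := bR (wallR (5 / 4)) (wallR' (5 / 4))) hRm hRm'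
  intro x hx
  obtain ⟨e1, e2⟩ := psi_eq_wall_right (1 + x) (show (1 : ℝ) < 1 + x by linarith [hx.1])
  obtain ⟨r1, r2⟩ := repr x hx
  exact ⟨by rw [e1, r1], by rw [e2, r2]⟩

/-- **On `−1/2 < x < 0`: `ψ(1 + x) = ψ_L(x) + b_L ψ_s(x)`** (the patch combination `comb bL` itself, `psi_eq_comb_left`).
[instance data] -/
theorem psi_repr_left : ∀ x ∈ Ioo (-(1 / 2) : ℝ) 0,
    psi (1 + x) = ((scalarLogSol pc qc 1 (14 / 5) Real.log) x).1 + bL * ((scalarSmallSol pc qc) x).1 ∧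
      psi' (1 + x) = ((scalarLogSol pc qc 1 (14 / 5) Real.log) x).2 + bL * ((scalarSmallSol pc qc) x).2 := by
  intro x hx
  obtain ⟨e1, e2⟩ := psi_eq_comb_left (1 + x) ⟨by linarith [hx.1], by linarith [hx.2]⟩
  rw [e1, e2, comb, comb', show (1 : ℝ) + x - 1 = x by ring]
  exact ⟨rfl, rfl⟩

/-! ### The schema instantiated: matching data and the generalised `Δ′` of ★ #13 -/

/-- The large (log-Frobenius) basis function `ψ_L(x) = (14/5) log|x|·ψ_s(x) + η(x)` of ★ #13's patch (`η(0) = 1`: already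
normalised to leading power `|x|⁰`). [instance data] -/
def psiL (x : ℝ) : ℝ := ((scalarLogSol pc qc 1 (14 / 5) Real.log) x).1

/-- The small basis function `ψ_s(x)` (`ψ_s ∼ x`: leading power `|x|¹` on the right; `−ψ_s ∼ |x|` on the left). [instance data] -/
def psiS (x : ℝ) : ℝ := ((scalarSmallSol pc qc) x).1

/-- **★ #13's OUTER SOLUTION HAS MATCHING DATA `(α⁺, β⁺, α⁻, β⁻) = (1, b_R, 1, −b_L)`** relative to the declared basis
(`ψ_L`, `ψ_s` on the right; `ψ_L`, `−ψ_s` on the left), the basis has the printed leading powers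
`(ν_L, ν_S) = (0, 1) = (largeIndex ½, smallIndex ½)` on both sides, and **the schema's `Δ′ = β⁺/α⁺ + β⁻/α⁻` is a
`Tearing.IsDeltaPrime` of `ψ`** (PEST-3 (89): at `μ = ½` the matching datum is the FKR jump).
[cite: PletzerBondesonDewar1994, §VIII eq. (89)–(90)] [cite: HamEtAl2013, §2] -/
theorem isMatchingData_psi :
    IsMatchingData 1 psi psiL psiS psiL (fun x => -psiS x) 1 (bR (wallR (5 / 4)) (wallR' (5 / 4))) 1 (-bL) ∧
      HasLeadingPower psiL (largeIndex (1 / 2)) (𝓝[>] 0) ∧ HasLeadingPower psiL (largeIndex (1 / 2)) (𝓝[<] 0) ∧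
      HasLeadingPower psiS (smallIndex (1 / 2)) (𝓝[>] 0) ∧
      HasLeadingPower (fun x => -psiS x) (smallIndex (1 / 2)) (𝓝[<] 0) ∧
      IsDeltaPrime psi psi' 1 (matchingDeltaPrime 1 (bR (wallR (5 / 4)) (wallR' (5 / 4))) 1 (-bL)) := by
  -- regularity of the patch data at the surface (as in `isDeltaPrime_of_matching`)
  obtain ⟨hSd, -, -, -⟩ := smallPatchOn_half 0 (by norm_num)
  have hEd : DifferentiableAt ℝ (scalarLogRegSol pc qc 1 (14 / 5)) 0 :=
    ((isScalarLogData.logRegSol 1 (14 / 5)).2 0 (by simpa using isScalarLogData.radius_pos)).1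
  have hs : HasDerivAt (fun x => ((scalarSmallSol pc qc) x).1) ((deriv (scalarSmallSol pc qc) 0).1) 0 :=
    (ContinuousLinearMap.fst ℝ ℝ ℝ).hasFDerivAt.comp_hasDerivAt 0 hSd.hasDerivAt
  have hs' : HasDerivAt (fun x => ((scalarSmallSol pc qc) x).2) ((deriv (scalarSmallSol pc qc) 0).2) 0 :=
    (ContinuousLinearMap.snd ℝ ℝ ℝ).hasFDerivAt.comp_hasDerivAt 0 hSd.hasDerivAt
  have hη : ContinuousAt (fun x => ((scalarLogRegSol pc qc 1 (14 / 5)) x).1) 0 :=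
    ((ContinuousLinearMap.fst ℝ ℝ ℝ).hasFDerivAt.comp_hasDerivAt 0 hEd.hasDerivAt).continuousAt
  have hζ : ContinuousAt (fun x => ((scalarLogRegSol pc qc 1 (14 / 5)) x).2) 0 :=
    ((ContinuousLinearMap.snd ℝ ℝ ℝ).hasFDerivAt.comp_hasDerivAt 0 hEd.hasDerivAt).continuousAt
  rw [deriv_small_zero] at hs hs'
  have hs0 : ((scalarSmallSol pc qc) 0).1 = 0 := by rw [small_zero]
  have hs'0 : ((scalarSmallSol pc qc) 0).2 = 1 := by rw [small_zero]
  have hη0 : ((scalarLogRegSol pc qc 1 (14 / 5)) 0).1 = 1 := by rw [reg_zero]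
  have hA : (1 : ℝ) * ((scalarLogRegSol pc qc 1 (14 / 5)) 0).1 ≠ 0 := by rw [hη0]; norm_num
  have hψ0 : psi 1 = 1 * ((scalarLogRegSol pc qc 1 (14 / 5)) 0).1 := by rw [hη0, psi_one]; norm_num
  have key := isMatchingData_logBranch (ψ := psi) (ψ' := psi') (rs := 1) (κ := 14 / 5) (A := 1)
    (Bp := bR (wallR (5 / 4)) (wallR' (5 / 4))) (Bm := bL) (δ := 1 / 2) (by norm_num) hs0 hs one_ne_zero hs'0 hs'
    hη (by rw [hη0]; norm_num) hζ hA hψ0 ?_ ?_ ?_ ?_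
  · obtain ⟨hM, hL1, hL2, hS1, hS2, hD⟩ := key
    have eL : (fun x => (14 / 5 * Real.log |x| * ((scalarSmallSol pc qc) x).1 + ((scalarLogRegSol pc qc 1 (14 / 5)) x).1)
        / ((scalarLogRegSol pc qc 1 (14 / 5)) 0).1) = psiL := by
      funext x; rw [hη0, div_one, psiL, log_fst]
    have eS : (fun x => ((scalarSmallSol pc qc) x).1 / (1 : ℝ)) = psiS := by funext x; rw [div_one, psiS]
    have eSm : (fun x => -(((scalarSmallSol pc qc) x).1 / (1 : ℝ))) = fun x => -psiS x := by funext x; rw [div_one, psiS]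
    have e1 : (1 : ℝ) * ((scalarLogRegSol pc qc 1 (14 / 5)) 0).1 = 1 := by rw [hη0]; norm_num
    rw [eL, eS, eSm, e1, mul_one, mul_one] at hM
    rw [eL] at hL1 hL2
    rw [eS] at hS1
    rw [eSm] at hS2
    rw [e1, mul_one, mul_one] at hD
    refine ⟨hM, ?_, ?_, ?_, ?_, hD⟩
    · simpa [largeIndex] using hL1
    · simpa [largeIndex] using hL2
    · have : smallIndex (1 / 2 : ℝ) = 1 := by unfold smallIndex; norm_num
      rw [this]; exact hS1
    · have : smallIndex (1 / 2 : ℝ) = 1 := by unfold smallIndex; norm_num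
      rw [this]; exact hS2
  · intro x hx
    rw [(psi_repr_right x hx).1, log_fst]; ring
  · intro x hx
    rw [(psi_repr_left x hx).1, log_fst]; ring
  · intro x hx
    rw [(psi_repr_right x hx).2, log_snd]; ring
  · intro x hx
    rw [(psi_repr_left x hx).2, log_snd]; ring

/-- **THE GENERALISED `Δ′` OF ★ #13 IS ITS CERTIFIED JUMP**: `matchingDeltaPrime 1 b_R 1 (−b_L) = deltaPrime (= b_R − b_L)`.
[cite: PletzerBondesonDewar1994, §VIII eq. (89)] -/
theorem matchingDeltaPrime_psi :
    matchingDeltaPrime 1 (bR (wallR (5 / 4)) (wallR' (5 / 4))) 1 (-bL) = deltaPrime := by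
  rw [matchingDeltaPrime, deltaPrime]; ring

/-- **`5.12620 < β⁺/α⁺ + β⁻/α⁻ < 5.12624`** for ★ #13's outer solution and basis (the schema's number on a certified row;
`deltaPrime_bounds` by name). [cite: HamEtAl2013, §2 (Δ′_∞)] -/
theorem matchingDeltaPrime_psi_bounds :
    (51262 / 10000 : ℝ) < matchingDeltaPrime 1 (bR (wallR (5 / 4)) (wallR' (5 / 4))) 1 (-bL) ∧
      matchingDeltaPrime 1 (bR (wallR (5 / 4)) (wallR' (5 / 4))) 1 (-bL) < (512624 / 100000 : ℝ) := by
  rw [matchingDeltaPrime_psi]; exact deltaPrime_bounds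

/-- **UNIQUENESS ON THE ROW**: any matching data of `ψ` relative to this basis equal `(1, b_R, 1, −b_L)` (the schema's
`IsMatchingData.unique` with `ν_L = 0 < 1 = ν_S`). [cite: PletzerBondesonDewar1994, §VI eq. (63)] -/
theorem matchingData_unique {αp βp αm βm : ℝ}
    (h : IsMatchingData 1 psi psiL psiS psiL (fun x => -psiS x) αp βp αm βm) :
    αp = 1 ∧ βp = bR (wallR (5 / 4)) (wallR' (5 / 4)) ∧ αm = 1 ∧ βm = -bL := by
  obtain ⟨hM, hL1, hL2, hS1, hS2, -⟩ := isMatchingData_psi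
  have hν : largeIndex (1 / 2 : ℝ) < smallIndex (1 / 2) := (largeIndex_lt_smallIndex (by norm_num)).1
  obtain ⟨h1, h2, h3, h4⟩ := h.unique hM hL1 hS1 hL2 hS2 hν
  exact ⟨h1, h2, h3, h4⟩

end TearingFRS1

end Summit.Ventures.FusionMHD.Models

end
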